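import Summits.QuantumFields.YangMills.Theorems.DirichletWindowLocalGaussianity
import Summits.QuantumFields.YangMills.Theorems.DirichletWindowXiDivergesOfFixedDistance
import Summits.QuantumFields.YangMills.Theorems.DirichletWindowAxialLogConvexity
import HarnessLib

/-!
# `DirichletWindow.XiDiverges` (item stmt-QuantumFields-8941): `ξ_lat(β) → ∞` uniformly over torus-limit states

Route `DirichletWindow` of `QuantumFields/YangMills`, support item
`Summit.QuantumFields.YangMills.Theses.DirichletWindow.XiDiverges` (shared verbatim with route `XiCompleteMonotonicity`):
for every compact simple `G`, faithful unitary `r` and `ε > 0` there is `β₁` such that for all `β ≥ β₁` and every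
infinite-volume torus-limit state `μ` at `β` the axial plaquette two-point function obeys `A e^{−m n} ≤ f_β(n e₀)` for all
`n`, with `A > 0` and `0 ≤ m ≤ ε` — the qualitative second half of Chatterjee's Problem 5.1 (arXiv:1803.01950) for
torus-limit states, WITHOUT assuming that a correlation length exists.

Proof: the landed door `xiDivergesOfFixedDistance_proof : AxialLogConvexity → FixedDistanceLower → PlaquetteVarianceUpper →
XiDiverges` (item 8943, reflection-positivity log-convexity + one-scale window) applied to `AxialLogConvexity_proof` (8940)
and the two conjuncts `fixedDistanceLower_proof` (8938), `plaquetteVarianceUpper_proof` (8939) of `localGaussianity_proof`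
(12314, line «exp-moment tangent law»: chessboard exponential moments ⊕ tangent law ⊕ axial kernel lower bound).

HONEST FRAMING: RECORD currency of a dormant summit route — `m ≤ ε` at every `ε` as `β → ∞` is divergence of the lattice
correlation length in lattice units, not a mass gap, not volume-uniform clustering at fixed `β`, not a continuum limit;
the Yang–Mills mass gap is NOT proved here (XI-DIV is banked, not a rung).
-/

set_option autoImplicit false

namespace Summit.QuantumFields.YangMills.Theorems

/-- **`XiDiverges` holds** (item stmt-QuantumFields-8941): `ξ_lat(β) → ∞` uniformly over infinite-volume torus-limit
states, by the landed door from `AxialLogConvexity`, `FixedDistanceLower`, `PlaquetteVarianceUpper`. -/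
theorem xiDiverges_proof : Summit.QuantumFields.YangMills.Theses.DirichletWindow.XiDiverges :=
  xiDivergesOfFixedDistance_proof AxialLogConvexity_proof fixedDistanceLower_proof plaquetteVarianceUpper_proof

end Summit.QuantumFields.YangMills.Theorems
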